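import Summits.MatrixMultiplication.MatrixMultiplication.Theorems.SoloBlindConjEReduction

/-!
# The binary lift in rank 8: Conjecture E attained with all members of size ≥ 7 (kernel witness)

Companion to `SoloBlindBinaryLift`.  The binary lift `S_7 = {a} ∪ {b_i, a + b_i : i ≤ 7} ⊂ 𝔽₃⁸` is zero-sum
free, the target `τ₇ = b₁ + ⋯ + b₇` is H-good, every representation of `τ₇` has size `≥ 7` (there are `43` of
size `7` and `42` of size `8`), and the Kraft mass is exactly `43/128 + 42/256 = 1/2`.  Rank `8` is far beyond
the reach of the exhaustive censuses (rank `≤ 5`); the certificate is a kernel evaluation over all `2^15` subsets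
(`decide +kernel`).  Consequence: no statement about representations of size `≤ 6` can detect this equality case
of Conjecture E.
-/

namespace Summit.MatrixMultiplication.MatrixMultiplication.Theorems

open Finset

/-- The rank-8 binary lift `S_7` as a table on `Fin 15`: `0 ↦ a = e₀`, `i ↦ b_i = e_i` (`i = 1..7`),
`7 + i ↦ a + b_i`. -/
def soloBlindLiftSeven : Fin 15 → (Fin 8 → ZMod 3) :=
  ![![1,0,0,0,0,0,0,0],
    ![0,1,0,0,0,0,0,0], ![0,0,1,0,0,0,0,0], ![0,0,0,1,0,0,0,0], ![0,0,0,0,1,0,0,0],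
    ![0,0,0,0,0,1,0,0], ![0,0,0,0,0,0,1,0], ![0,0,0,0,0,0,0,1],
    ![1,1,0,0,0,0,0,0], ![1,0,1,0,0,0,0,0], ![1,0,0,1,0,0,0,0], ![1,0,0,0,1,0,0,0],
    ![1,0,0,0,0,1,0,0], ![1,0,0,0,0,0,1,0], ![1,0,0,0,0,0,0,1]]

/-- The rank-8 target `τ₇ = b₁ + ⋯ + b₇`. -/
def soloBlindLiftSevenTarget : Fin 8 → ZMod 3 := ![0,1,1,1,1,1,1,1]

/-- `S_7` is zero-sum free. -/
theorem soloBlindLiftSeven_zsf :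
    ∀ T ⊆ (Finset.univ : Finset (Fin 15)), T.Nonempty → ∑ i ∈ T, soloBlindLiftSeven i ≠ 0 := by
  decide +kernel

/-- `τ₇` is H-good on `S_7`. -/
theorem soloBlindLiftSeven_hgood :
    ∀ T ⊆ (Finset.univ : Finset (Fin 15)),
      ∑ i ∈ T, soloBlindLiftSeven i ≠ soloBlindLiftSevenTarget + soloBlindLiftSevenTarget := by
  decide +kernel

/-- Every representation of `τ₇` on `S_7` has at least `7` elements. -/
theorem soloBlindLiftSeven_minsize :
    ∀ T ⊆ (Finset.univ : Finset (Fin 15)),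
      ∑ i ∈ T, soloBlindLiftSeven i = soloBlindLiftSevenTarget → 7 ≤ T.card := by
  decide +kernel

/-- The Kraft mass of `τ₇` on `S_7` is exactly `1/2`. -/
theorem soloBlindLiftSeven_mass :
    soloBlindMass soloBlindLiftSeven Finset.univ soloBlindLiftSevenTarget = 1 / 2 := by
  decide +kernel

/-- CONJECTURE E IS TIGHT IN RANK 8 WITH NO MEMBER OF SIZE `≤ 6`. -/
theorem soloBlind_conjE_tight_rank8 :
    ∃ (h : Fin 15 → (Fin 8 → ZMod 3)) (τ : Fin 8 → ZMod 3),
      (∀ T ⊆ (Finset.univ : Finset (Fin 15)), T.Nonempty → ∑ i ∈ T, h i ≠ 0) ∧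
      (∀ T ⊆ (Finset.univ : Finset (Fin 15)), ∑ i ∈ T, h i ≠ τ + τ) ∧
      (∀ T ⊆ (Finset.univ : Finset (Fin 15)), ∑ i ∈ T, h i = τ → 7 ≤ T.card) ∧
      soloBlindMass h Finset.univ τ = 1 / 2 :=
  ⟨soloBlindLiftSeven, soloBlindLiftSevenTarget, soloBlindLiftSeven_zsf, soloBlindLiftSeven_hgood,
    soloBlindLiftSeven_minsize, soloBlindLiftSeven_mass⟩

end Summit.MatrixMultiplication.MatrixMultiplication.Theorems
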